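import Literature.NumberTheory.Sieve.RoughNumbersBuchstabPrimeSumThree
import HarnessLib

/-!
# The main sum of the Buchstab iteration: `∑_{y ≤ p < z} x ω(u_p)/(p log p) = (x/log x)(u ω(u) − k ω(k)) + O(x/log² y)`

Topic `Literature/NumberTheory/Sieve`. Everything here is PROVED. This file combines the two
Abel-summation estimates (`RoughNumbersBuchstabPrimeSum*.lean`: `k = 2` and `k ≥ 3`) with the
main-term evaluation `integral_buchstabWeight_eq` into the single estimate consumed by the
inductive step of Lichtman's Lemma 6.1 (`RoughNumbersBuchstab.lean`):

* `abs_integral_sub_integral_le_two_mul_of_shift` — moving the endpoints of an integral by at most `1` each costs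
  at most `2 sup |g|`;
* `abs_sum_buchstabWeight_sub_main_le` — for `k ≥ 2`, `e ≤ a ≤ y ≤ a + 1`, `a ≤ b < z ≤ b + 1`,
  `log z = (log x)/k`, `k ≤ u = log x/log y`, `log x ≤ (k + 1) log y`, `log x ≤ 2(k + 1) log a`,
  `log b ≤ 3 log a`, primes of the range `≥ y`:
  `|∑_{⌊a⌋ < p ≤ ⌊b⌋} x ω(log x/log p − 1)/(p log p) − (x/log x)(u ω(u) − k ω(k))| ≤ ((3k + 38) C₀ + 2) x/log² a`.

## References

* J. D. Lichtman, arXiv:2109.02851, §6.1, Lemma 6.1. [Lichtman2025LinearSieve]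
* G. Harman, *Prime-Detecting Sieves* (2007), §1.4 (1.4.14), Appendix A.2.
-/

open Finset Real MeasureTheory Set intervalIntegral
open scoped Chebyshev

noncomputable section

namespace Literature.NumberTheory.Sieve

/-- Moving both endpoints of `∫ g` by at most `1` (inside an interval `[a, z]` on which `|g| ≤ B`)
changes the integral by at most `2B`: `|∫_a^b g − ∫_y^z g| ≤ 2B` for `a ≤ y ≤ a + 1`,
`a ≤ b ≤ z ≤ b + 1`, `y ≤ z`. [folklore] -/
theorem abs_integral_sub_integral_le_two_mul_of_shift {g : ℝ → ℝ} {a b y z B : ℝ} (hay : a ≤ y) (hya : y ≤ a + 1)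
    (hab : a ≤ b) (hbz : b ≤ z) (hzb : z ≤ b + 1) (hyz : y ≤ z) (hg : ContinuousOn g (Icc a z))
    (hB : ∀ t ∈ Icc a z, |g t| ≤ B) :
    |(∫ t in a..b, g t) - ∫ t in y..z, g t| ≤ 2 * B := by
  have haz : a ≤ z := hab.trans hbz
  have hint : ∀ c d : ℝ, c ∈ Icc a z → d ∈ Icc a z → IntervalIntegrable g volume c d :=
    fun c d hc hd => (hg.mono (uIcc_subset_Icc hc hd)).intervalIntegrable
  have hma : a ∈ Icc a z := ⟨le_rfl, haz⟩
  have hmy : y ∈ Icc a z := ⟨hay, hyz⟩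
  have hmb : b ∈ Icc a z := ⟨hab, hbz⟩
  have hmz : z ∈ Icc a z := ⟨haz, le_rfl⟩
  have h1 : ∫ t in a..b, g t = (∫ t in a..y, g t) + ∫ t in y..b, g t :=
    (intervalIntegral.integral_add_adjacent_intervals (hint a y hma hmy) (hint y b hmy hmb)).symm
  have h2 : ∫ t in y..z, g t = (∫ t in y..b, g t) + ∫ t in b..z, g t :=
    (intervalIntegral.integral_add_adjacent_intervals (hint y b hmy hmb) (hint b z hmb hmz)).symm
  have hbound : ∀ c d : ℝ, c ∈ Icc a z → d ∈ Icc a z → |∫ t in c..d, g t| ≤ B * |d - c| := by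
    intro c d hc hd
    have h := intervalIntegral.norm_integral_le_of_norm_le_const (f := g) (a := c) (b := d) (C := B)
      fun t ht => by
        rw [Real.norm_eq_abs]
        exact hB t (uIcc_subset_Icc hc hd (uIoc_subset_uIcc ht))
    rwa [Real.norm_eq_abs] at h
  have hB0 : 0 ≤ B := (abs_nonneg _).trans (hB a hma)
  have i1 := hbound a y hma hmy
  have i2 := hbound b z hmb hmz
  rw [abs_of_nonneg (by linarith : 0 ≤ y - a)] at i1
  rw [abs_of_nonneg (by linarith : 0 ≤ z - b)] at i2
  rw [h1, h2, show (∫ t in a..y, g t) + (∫ t in y..b, g t) - ((∫ t in y..b, g t) + ∫ t in b..z, g t) =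
    (∫ t in a..y, g t) - ∫ t in b..z, g t by ring]
  calc |(∫ t in a..y, g t) - ∫ t in b..z, g t| ≤ |∫ t in a..y, g t| + |∫ t in b..z, g t| := abs_sub _ _
    _ ≤ B * (y - a) + B * (z - b) := add_le_add i1 i2
    _ ≤ B * 1 + B * 1 := by gcongr <;> linarith
    _ = 2 * B := by ring

/-- **The main sum of the Buchstab iteration.** For `k ≥ 2`, `e ≤ a ≤ y ≤ a + 1`,
`a ≤ b < z ≤ b + 1`, `log z = (log x)/k`, `k ≤ log x/log y`, `log x ≤ (k + 1) log y`,
`log x ≤ 2(k + 1) log a`, `log b ≤ 3 log a`, `x ≥ 1`, all primes `p ∈ (⌊a⌋, ⌊b⌋]` at least `y`, and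
`|ϑ(t) − t| ≤ C₀ t/log² t` (`t ≥ 2`):
`|∑_{⌊a⌋ < p ≤ ⌊b⌋} x ω(log x/log p − 1)/(p log p) − (x/log x)(u ω(u) − k ω(k))| ≤ ((3k + 38) C₀ + 2) x/log² a`,
`u = log x/log y` (Lichtman's Lemma 6.1, inductive step; Harman (1.4.14): "Partial summation as
before then gives … The change of variables `v = (log x)/(log y)` gives …").
[cite: Lichtman2025LinearSieve, Lemma 6.1] -/
theorem abs_sum_buchstabWeight_sub_main_le {k : ℕ} (hk : 2 ≤ k) {x y z a b C₀ : ℝ} (hC₀ : 0 ≤ C₀)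
    (hE : ∀ t : ℝ, 2 ≤ t → |θ t - t| ≤ C₀ * t / Real.log t ^ 2)
    (ha : Real.exp 1 ≤ a) (hay : a ≤ y) (hya : y ≤ a + 1) (hab : a ≤ b) (hbz : b < z)
    (hzb : z ≤ b + 1) (hyz : y ≤ z) (hz : Real.log z = Real.log x / k)
    (hu : (k : ℝ) ≤ Real.log x / Real.log y) (hxy : Real.log x ≤ (k + 1) * Real.log y)
    (hxa : Real.log x ≤ 2 * (k + 1) * Real.log a) (hba : Real.log b ≤ 3 * Real.log a) (hx : 1 ≤ x)
    (hpy : ∀ p ∈ (Finset.Ioc ⌊a⌋₊ ⌊b⌋₊).filter Nat.Prime, y ≤ (p : ℝ)) :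
    |∑ p ∈ (Finset.Ioc ⌊a⌋₊ ⌊b⌋₊).filter Nat.Prime,
        x * buchstabOmega (Real.log x / Real.log p - 1) / (p * Real.log p) -
      x / Real.log x * (Real.log x / Real.log y * buchstabOmega (Real.log x / Real.log y) -
        k * buchstabOmega k)| ≤ ((3 * k + 38) * C₀ + 2) * x / Real.log a ^ 2 := by
  -- numerics
  have hk2 : (2 : ℝ) ≤ k := by exact_mod_cast hk
  have ha0 : 0 < a := (Real.exp_pos 1).trans_le ha
  have hla : 1 ≤ Real.log a := by rw [Real.le_log_iff_exp_le ha0]; exact ha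
  have ha1 : 1 < a := by
    by_contra h
    push Not at h
    have := Real.log_nonpos ha0.le h
    linarith
  have hy1 : 1 < y := ha1.trans_le hay
  have hb0 : 0 < b := ha0.trans_le hab
  have hz0 : 0 < z := hb0.trans hbz
  have hly : 0 < Real.log y := Real.log_pos hy1
  have hLx : 0 < Real.log x := by
    have : 0 < Real.log x / Real.log y := lt_of_lt_of_le (by linarith) hu
    exact (div_pos_iff_of_pos_right hly).mp this
  have hx0 : 0 ≤ x := by linarith
  have hlbz : Real.log b < Real.log z := Real.log_lt_log hb0 hbz
  have hkb : k * Real.log b < Real.log x := by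
    calc (k : ℝ) * Real.log b < k * Real.log z := by gcongr
      _ = Real.log x := by rw [hz]; field_simp
  have haz : a ≤ z := hab.trans hbz.le
  -- on `[a, z]`: `t > 1`, `log t ≥ log a ≥ 1`, `φ(t) = log x/log t − 1 ≥ k − 1 ≥ 1`
  have hmem : ∀ t ∈ Icc a z, 1 < t ∧ Real.log a ≤ Real.log t ∧ (k : ℝ) - 1 ≤ Real.log x / Real.log t - 1 := by
    intro t ht
    have ht1 : 1 < t := ha1.trans_le ht.1
    have hlt : 0 < Real.log t := Real.log_pos ht1
    refine ⟨ht1, Real.log_le_log ha0 ht.1, ?_⟩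
    have hz1 : Real.log t ≤ Real.log z := Real.log_le_log (by linarith) ht.2
    have : (k : ℝ) ≤ Real.log x / Real.log t := by
      rw [le_div_iff₀ hlt]
      calc (k : ℝ) * Real.log t ≤ k * Real.log z := by gcongr
        _ = Real.log x := by rw [hz]; field_simp
    linarith
  -- the main term
  have hmainTerm := integral_buchstabWeight_eq hk2 hy1 hyz hz hu
  -- the weight `g` and its sup bound `x/(a log² a)` on `[a, z]`
  set g : ℝ → ℝ := fun t => x * buchstabOmega (Real.log x / Real.log t - 1) / (t * Real.log t ^ 2)
    with hg_def
  have hsup : ∀ t ∈ Icc a z, x / (t * Real.log t ^ 2) ≤ x / (a * Real.log a ^ 2) := by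
    intro t ht
    obtain ⟨ht1, hlat, -⟩ := hmem t ht
    apply div_le_div_of_nonneg_left hx0 (by positivity)
    exact mul_le_mul ht.1 (pow_le_pow_left₀ (by linarith) hlat 2) (by positivity) (by linarith)
  have hB2 : 2 * (x / (a * Real.log a ^ 2)) ≤ 2 * x / Real.log a ^ 2 := by
    have : x / (a * Real.log a ^ 2) ≤ x / Real.log a ^ 2 :=
      div_le_div_of_nonneg_left hx0 (by positivity) (le_mul_of_one_le_left (by positivity) ha1.le)
    rw [mul_div_assoc]
    linarith
  rcases lt_or_ge k 3 with hk3 | hk3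
  · -- `k = 2`: `ω(s) = 1/s` on the range
    have hk_eq : k = 2 := by omega
    subst hk_eq
    push_cast at *
    set g₂ : ℝ → ℝ := fun t => x / (t * Real.log t * (Real.log x - Real.log t)) with hg₂_def
    -- on `[a, z]`: `log t ≤ log x − log t` (as `2 log t ≤ 2 log z = log x`)
    have hmem2 : ∀ t ∈ Icc a z, Real.log t ≤ Real.log x - Real.log t := by
      intro t ht
      obtain ⟨ht1, -, -⟩ := hmem t ht
      have hz1 : Real.log t ≤ Real.log z := Real.log_le_log (by linarith) ht.2
      have : 2 * Real.log z = Real.log x := by rw [hz]; ring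
      linarith
    have hflav := abs_sum_sub_integral_le_two hC₀ hE ha hab (by linarith) hba hx0
    -- the sum in the statement is the `k = 2` sum
    have hsum : ∑ p ∈ (Finset.Ioc ⌊a⌋₊ ⌊b⌋₊).filter Nat.Prime,
        x * buchstabOmega (Real.log x / Real.log p - 1) / (p * Real.log p) =
        ∑ p ∈ (Finset.Ioc ⌊a⌋₊ ⌊b⌋₊).filter Nat.Prime, x / (p * (Real.log x - Real.log p)) := by
      refine Finset.sum_congr rfl fun p hp => ?_
      have hpP := (Finset.mem_filter.mp hp).2
      have hpIoc := Finset.mem_Ioc.mp (Finset.mem_filter.mp hp).1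
      have hpb : (p : ℝ) ≤ b := le_trans (by exact_mod_cast hpIoc.2) (Nat.floor_le hb0.le)
      have hap : a ≤ (p : ℝ) := by
        have h2 : (⌊a⌋₊ : ℝ) + 1 ≤ p := by exact_mod_cast hpIoc.1
        linarith [Nat.lt_floor_add_one a]
      have hp1 : (1 : ℝ) < p := by exact_mod_cast hpP.one_lt
      have hlp : 0 < Real.log p := Real.log_pos hp1
      have hpz : (p : ℝ) ≤ z := hpb.trans hbz.le
      have hLp := hmem2 p ⟨hap, hpz⟩
      have hlow : 1 ≤ Real.log x / Real.log p - 1 := by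
        rw [le_sub_iff_add_le, le_div_iff₀ hlp]; linarith
      have hupp : Real.log x / Real.log p - 1 ≤ 2 := by
        have hlyp : Real.log y ≤ Real.log p := Real.log_le_log (by linarith) (hpy p hp)
        rw [sub_le_iff_le_add, div_le_iff₀ hlp]
        calc Real.log x ≤ (2 + 1) * Real.log y := hxy
          _ ≤ (2 + 1) * Real.log p := by gcongr
      rw [buchstabOmega_eq_inv hlow hupp]
      have hne : Real.log x - Real.log p ≠ 0 := by linarith
      have hp0 : (p : ℝ) ≠ 0 := by positivity
      field_simp
    -- `∫_y^z g₂ = ∫_y^z g`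
    have hint_eq : ∫ t in y..z, g₂ t = ∫ t in y..z, g t := by
      refine intervalIntegral.integral_congr fun t ht => ?_
      rw [uIcc_of_le hyz] at ht
      have htaz : t ∈ Icc a z := ⟨hay.trans ht.1, ht.2⟩
      obtain ⟨ht1, hlat, hφ1⟩ := hmem t htaz
      have hlt : 0 < Real.log t := Real.log_pos ht1
      have hupp : Real.log x / Real.log t - 1 ≤ 2 := by
        have hlyt : Real.log y ≤ Real.log t := Real.log_le_log (by linarith) ht.1
        rw [sub_le_iff_le_add, div_le_iff₀ hlt]
        calc Real.log x ≤ (2 + 1) * Real.log y := hxy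
          _ ≤ (2 + 1) * Real.log t := by gcongr
      rw [hg_def, hg₂_def]
      simp only
      rw [buchstabOmega_eq_inv (by linarith) hupp]
      have hne : Real.log x - Real.log t ≠ 0 := by have := hmem2 t htaz; linarith
      have ht0 : t ≠ 0 := by positivity
      field_simp
    -- continuity and sup bound of `g₂` on `[a, z]`
    have hg₂c : ContinuousOn g₂ (Icc a z) := by
      intro t ht
      obtain ⟨ht1, hlat, -⟩ := hmem t ht
      have h1 : t ≠ 0 := by positivity
      have h2 : t * Real.log t * (Real.log x - Real.log t) ≠ 0 := by
        have := hmem2 t ht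
        apply mul_ne_zero (mul_ne_zero h1 (by linarith)); linarith
      refine ContinuousAt.continuousWithinAt ?_
      rw [hg₂_def]
      fun_prop (disch := assumption)
    have hg₂B : ∀ t ∈ Icc a z, |g₂ t| ≤ x / (a * Real.log a ^ 2) := by
      intro t ht
      obtain ⟨ht1, hlat, -⟩ := hmem t ht
      have hLt := hmem2 t ht
      have hlt : 1 ≤ Real.log t := hla.trans hlat
      have hD : t * Real.log t * Real.log t ≤ t * Real.log t * (Real.log x - Real.log t) :=
        mul_le_mul_of_nonneg_left hLt (by positivity)
      have hD0 : 0 < t * Real.log t * Real.log t := by positivity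
      rw [hg₂_def]
      simp only
      rw [abs_of_nonneg (div_nonneg hx0 (hD0.le.trans hD))]
      calc x / (t * Real.log t * (Real.log x - Real.log t)) ≤ x / (t * Real.log t * Real.log t) :=
            div_le_div_of_nonneg_left hx0 hD0 hD
        _ = x / (t * Real.log t ^ 2) := by ring
        _ ≤ x / (a * Real.log a ^ 2) := hsup t ht
    have hmove := abs_integral_sub_integral_le_two_mul_of_shift hay hya hab hbz.le hzb hyz hg₂c hg₂B
    rw [hsum, ← hmainTerm, ← hint_eq]
    have htri := abs_sub_le
      (∑ p ∈ (Finset.Ioc ⌊a⌋₊ ⌊b⌋₊).filter Nat.Prime, x / (p * (Real.log x - Real.log p)))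
      (∫ t in a..b, g₂ t) (∫ t in y..z, g₂ t)
    calc _ ≤ 38 * C₀ * x / Real.log a ^ 2 + 2 * (x / (a * Real.log a ^ 2)) := by linarith
      _ ≤ 38 * C₀ * x / Real.log a ^ 2 + 2 * x / Real.log a ^ 2 := by linarith
      _ ≤ ((3 * (2 : ℝ) + 38) * C₀ + 2) * x / Real.log a ^ 2 := by
          rw [← add_div, div_le_div_iff_of_pos_right (by positivity)]
          nlinarith
  · -- `k ≥ 3`
    have hflav := abs_sum_sub_integral_le_of_three_le hk3 hC₀ hE ha hab hkb hxa hba hx0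
    have hgc : ContinuousOn g (Icc a z) := by
      intro t ht
      obtain ⟨ht1, hlat, hφ1⟩ := hmem t ht
      have h1 : t ≠ 0 := by positivity
      have hl0 : Real.log t ≠ 0 := by linarith
      have h2 : t * Real.log t ^ 2 ≠ 0 := mul_ne_zero h1 (pow_ne_zero 2 hl0)
      have hφc : ContinuousAt (fun s : ℝ => Real.log x / Real.log s - 1) t := by
        fun_prop (disch := assumption)
      have hk1 : (1 : ℝ) < (k : ℝ) - 1 := by
        have : (3 : ℝ) ≤ k := by exact_mod_cast hk3
        linarith
      have hA : ContinuousAt (fun s : ℝ => buchstabOmega (Real.log x / Real.log s - 1)) t :=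
        (continuousAt_buchstabOmega (by linarith)).comp hφc
      refine ContinuousAt.continuousWithinAt ?_
      rw [hg_def]
      exact (continuousAt_const.mul hA).div (by fun_prop (disch := assumption)) h2
    have hgB : ∀ t ∈ Icc a z, |g t| ≤ x / (a * Real.log a ^ 2) := by
      intro t ht
      obtain ⟨ht1, hlat, -⟩ := hmem t ht
      have hlt : 1 ≤ Real.log t := hla.trans hlat
      rw [hg_def]
      simp only
      rw [abs_div, abs_mul, abs_of_nonneg hx0, abs_of_nonneg (buchstabOmega_nonneg _),
        abs_of_pos (by positivity : 0 < t * Real.log t ^ 2)]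
      calc x * buchstabOmega (Real.log x / Real.log t - 1) / (t * Real.log t ^ 2)
          ≤ x * 1 / (t * Real.log t ^ 2) := by gcongr; exact buchstabOmega_le_one _
        _ = x / (t * Real.log t ^ 2) := by rw [mul_one]
        _ ≤ x / (a * Real.log a ^ 2) := hsup t ht
    have hmove := abs_integral_sub_integral_le_two_mul_of_shift hay hya hab hbz.le hzb hyz hgc hgB
    rw [← hmainTerm]
    have htri := abs_sub_le
      (∑ p ∈ (Finset.Ioc ⌊a⌋₊ ⌊b⌋₊).filter Nat.Prime,
        x * buchstabOmega (Real.log x / Real.log p - 1) / (p * Real.log p))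
      (∫ t in a..b, g t) (∫ t in y..z, g t)
    have hk0 : (0 : ℝ) ≤ k := Nat.cast_nonneg k
    calc _ ≤ (3 * k + 14) * C₀ * x / Real.log a ^ 2 + 2 * (x / (a * Real.log a ^ 2)) := by linarith
      _ ≤ (3 * k + 14) * C₀ * x / Real.log a ^ 2 + 2 * x / Real.log a ^ 2 := by linarith
      _ ≤ ((3 * k + 38) * C₀ + 2) * x / Real.log a ^ 2 := by
          rw [← add_div, div_le_div_iff_of_pos_right (by positivity)]
          nlinarith

end Literature.NumberTheory.Sieve
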